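import Literature.Probability.Percolation.KSTPeriodicBridges
import Literature.Probability.Percolation.KSTPeriodicDualMeasure
import Literature.Probability.Percolation.KSTPeriodicDualTransfer
import HarnessLib

/-!
# KST-type RSW for periodic measures: short crossings give arms (Lemma 1(ii))

Topic `Literature/Probability/Percolation`. Proof of `ArmsOfShortCrossings k t`
(`KSTPeriodicStatements.lean`), the weak constant form of [KohlerSchindlerTassion2023, Lemma 1(ii)
with Comment 1] for `kℤ² ⋊ D₄`-periodic positively associated measures carried by lattice
configurations, from the planar inputs `ArchesMeet`, `PartsToSegmentsMeet` (walk topology) and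
`ArmDuality` (arm / dual-bridge duality): `armsOfShortCrossings_of`.

The argument is the paper's "(5) = dual of (4)", run in the high regime. With `n = 64a` and the
dual measure `μ* = μ ∘ dualConfig⁻¹` (an `Admissible k (t + 1)` probability measure carried by
lattice configurations, `KSTPeriodicDualMeasure.lean`):
* `1 - μ*(bridge (t+1) a n) ≤ μ(arm t a n)` (`KSTPeriodicDualTransfer.lean`);
* if the bridge variant of a box `R_t(n + a, n)` has probability `> 1 - δ⁵` then, by the
  square-root trick over its five realisations (`parts_subset_union`, equally likely corner events,
  `KSTPeriodicBridgesParts.lean`), the left–right crossing of the box or the corner event `𝓔` has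
  probability `> 1 - δ` (`real_lrRect_or_real_corner_of_parts`); in both cases gluing
  (`KSTPeriodicBridgesGlue.lean`, `KSTPeriodicBridgesArch.lean`) yields a left–right crossing of
  `R_t(9n, n)` with probability `≥ (1 - δ)^{2302}` (`real_long_of_parts`);
* a short-way crossing `𝓒_t(N, 8N)` for `N = n + k` excludes the dual long crossing
  (`KSTPeriodicDualTransfer.lean`), so `ε ≤ μ(𝓒_t(N, 8N)) ≤ 1 - (1 - δ)^{2302} ≤ 2302 δ`;
with `δ = min(ε / 4604, 1)` this is absurd, whence `μ(arm t a n) ≥ δ⁵`.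

## References

* [KohlerSchindlerTassion2023] L. Köhler-Schindler, V. Tassion, *Crossing probabilities for
  planar percolation*, Duke Math. J. 172 (2023) 809–838, Lemma 1(ii), §3, and Comment 1.
-/

namespace Literature.Probability.Percolation

open _root_.MeasureTheory LatticeModels

noncomputable section

namespace KSTPeriodic

variable {k t : ℕ} {μ : Measure (BondConfig (Site 2))}

/-! ### The square-root trick over the realisations of the bridge event -/

/-- **Dichotomy in the high regime** ([KohlerSchindlerTassion2023, §3]: "by the square-root-trick
and invariance under symmetries, `max{P[𝓔], P[𝓒(n + αn, n)]} ≥ 1 - (1 - P[𝓑̃(n)])^{1/5}`"): for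
a box `[L, R] × [B, T]` symmetric about `(-t/2, -t/2)` with symmetric thresholds `xl, xr`, if the
connection from the left part to the right part has probability `> 1 - δ⁵` then the left–right
crossing or the corner event "left part ↔ bottom-right segment" has probability `> 1 - δ`.
[cite: KohlerSchindlerTassion2023, §3, proof of Lemma 1] -/
theorem real_lrRect_or_real_corner_of_parts [IsProbabilityMeasure μ] (hμ : Admissible k t μ)
    {L R B T xl xr : ℤ} (hLR : L + R = -(t : ℤ)) (hBT : B + T = -(t : ℤ)) (hx : xl + xr = -(t : ℤ))
    {δ : ℝ} (hδ : 0 ≤ δ)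
    (h : 1 - δ ^ 5 < μ.real (openCrossing (rect L R B T)
        {x | x ∈ rect L R B T ∧ (x 0 = L ∨ ((x 1 = T ∨ x 1 = B) ∧ x 0 ≤ xl))}
        {x | x ∈ rect L R B T ∧ (x 0 = R ∨ ((x 1 = T ∨ x 1 = B) ∧ xr ≤ x 0))})) :
    1 - δ < μ.real (lrRect L R B T) ∨
    1 - δ < μ.real (openCrossing (rect L R B T)
        {x | x ∈ rect L R B T ∧ (x 0 = L ∨ ((x 1 = T ∨ x 1 = B) ∧ x 0 ≤ xl))}
        {x | x ∈ rect L R B T ∧ x 1 = B ∧ xr ≤ x 0}) := by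
  by_contra hcon
  rw [not_or, not_lt, not_lt] at hcon
  obtain ⟨hC, hE⟩ := hcon
  set C : Set (BondConfig (Site 2)) := lrRect L R B T with hCdef
  set E₁ : Set (BondConfig (Site 2)) := openCrossing (rect L R B T)
    {x | x ∈ rect L R B T ∧ (x 0 = L ∨ ((x 1 = T ∨ x 1 = B) ∧ x 0 ≤ xl))}
    {x | x ∈ rect L R B T ∧ x 1 = B ∧ xr ≤ x 0} with hE₁
  set E₂ : Set (BondConfig (Site 2)) := openCrossing (rect L R B T)
    {x | x ∈ rect L R B T ∧ (x 0 = R ∨ ((x 1 = T ∨ x 1 = B) ∧ xr ≤ x 0))}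
    {x | x ∈ rect L R B T ∧ x 1 = B ∧ x 0 ≤ xl} with hE₂
  set E₃ : Set (BondConfig (Site 2)) := openCrossing (rect L R B T)
    {x | x ∈ rect L R B T ∧ (x 0 = L ∨ ((x 1 = T ∨ x 1 = B) ∧ x 0 ≤ xl))}
    {x | x ∈ rect L R B T ∧ x 1 = T ∧ xr ≤ x 0} with hE₃
  set E₄ : Set (BondConfig (Site 2)) := openCrossing (rect L R B T)
    {x | x ∈ rect L R B T ∧ (x 0 = R ∨ ((x 1 = T ∨ x 1 = B) ∧ xr ≤ x 0))}
    {x | x ∈ rect L R B T ∧ x 1 = T ∧ x 0 ≤ xl} with hE₄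
  have h2 : μ.real E₂ = μ.real E₁ := real_flip_parts hμ hLR hx B
  have h3 : μ.real E₃ = μ.real E₁ := real_updown_parts hμ hBT xl xr
  have h4 : μ.real E₄ = μ.real E₃ := real_flip_parts hμ hLR hx T
  set Ev : Fin 5 → Set (BondConfig (Site 2)) := ![C, E₁, E₂, E₃, E₄] with hEv
  have hsq := sqrt_trick hμ (Finset.univ : Finset (Fin 5)) (E := Ev)
    (fun i _ => by fin_cases i <;> exact isUpperSet_openCrossing _ _ _)
    (fun i _ => by fin_cases i <;> exact measurableSet_openCrossing_of_countable _ _ _) (q := 1 - δ)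
    (fun i _ => by
      fin_cases i
      · exact hC
      · exact hE
      · exact h2.le.trans hE
      · exact h3.le.trans hE
      · exact (h4.trans h3).le.trans hE) (by linarith)
  have hsub : (openCrossing (rect L R B T)
      {x | x ∈ rect L R B T ∧ (x 0 = L ∨ ((x 1 = T ∨ x 1 = B) ∧ x 0 ≤ xl))}
      {x | x ∈ rect L R B T ∧ (x 0 = R ∨ ((x 1 = T ∨ x 1 = B) ∧ xr ≤ x 0))} :
        Set (BondConfig (Site 2))) ⊆ ⋃ i ∈ (Finset.univ : Finset (Fin 5)), Ev i := by
    intro ω hω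
    rcases parts_subset_union L R B T xl xr hω with (((h0 | h1) | h2') | h3') | h4'
    · exact Set.mem_iUnion₂.2 ⟨0, Finset.mem_univ _, h0⟩
    · exact Set.mem_iUnion₂.2 ⟨1, Finset.mem_univ _, h1⟩
    · exact Set.mem_iUnion₂.2 ⟨2, Finset.mem_univ _, h2'⟩
    · exact Set.mem_iUnion₂.2 ⟨3, Finset.mem_univ _, h3'⟩
    · exact Set.mem_iUnion₂.2 ⟨4, Finset.mem_univ _, h4'⟩
  have hmono := measureReal_mono (μ := μ) hsub (measure_ne_top _ _)
  have hcard : (1 - (1 - δ)) ^ (Finset.univ : Finset (Fin 5)).card = δ ^ 5 := by simp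
  rw [hcard] at hsq
  linarith

/-! ### The high regime of eq. (4): long crossings from very likely bridge variants -/

/-- **Constant form of eq. (4) of [KohlerSchindlerTassion2023] in the high regime**: for `k ≥ 1`,
`a = km`, `n = 64a` and `0 ≤ δ ≤ 1`, if the bridge variant `bridge t a n` (margin `a`) has
probability `> 1 - δ⁵` then the horizontal crossing of `R_t(9n, n)` has probability
`≥ (1 - δ)^{2302}`: by the dichotomy, either the left–right crossing of `R_t(n + a, n)` has
probability `> 1 - δ` and `1022` gluing steps by `a` (`pow_le_real_lrRect_extend`) followed by a
translation by `-511a` give the claim with exponent `2045`, or the corner event does, the arch event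
has probability `≥ (1 - δ)²` (`mul_le_real_arch`) and `1151` translated arches
(`pow_real_arch_le_real_lrRect`) followed by a translation by `-575a` give exponent `2302`.
[cite: KohlerSchindlerTassion2023, Lemma 1 and §3, proof of (4)] -/
theorem real_long_of_bridge [IsProbabilityMeasure μ] (hAr : ArchesMeet) (hPS : PartsToSegmentsMeet)
    (hμ : Admissible k t μ) (hL : LatticeCarried μ) (hk : 1 ≤ k) {m : ℕ} (hm : 1 ≤ m) {δ : ℝ}
    (hδ0 : 0 ≤ δ) (hδ1 : δ ≤ 1) (h : 1 - δ ^ 5 < μ.real (bridge t (k * m) (64 * (k * m)))) :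
    (1 - δ) ^ 2302 ≤ μ.real (lrRect (-((576 * (k * m) : ℕ) : ℤ) - t) (576 * (k * m) : ℕ)
      (-((64 * (k * m) : ℕ) : ℤ) - t) (64 * (k * m) : ℕ)) := by
  have h1δ : 0 ≤ 1 - δ := by linarith
  have h1δ' : 1 - δ ≤ 1 := by linarith
  have hkm : (1 : ℤ) ≤ (k : ℤ) * m := by
    have : 1 ≤ k * m := Nat.one_le_iff_ne_zero.2 (Nat.mul_ne_zero (by omega) (by omega))
    exact_mod_cast this
  rw [bridge_eq] at h
  rcases real_lrRect_or_real_corner_of_parts hμ (by push_cast; ring) (by push_cast; ring)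
    (by push_cast; ring) hδ0 h with hC | hE
  · -- second case: standard gluing
    have hext := pow_le_real_lrRect_extend hμ hL
      (L := -(((64 * (k * m) : ℕ) : ℤ) + (k * m : ℕ)) - t)
      (R := ((64 * (k * m) : ℕ) : ℤ) + (k * m : ℕ)) (B := -((64 * (k * m) : ℕ) : ℤ) - t)
      (T := (64 * (k * m) : ℕ)) m (by push_cast; nlinarith) (by push_cast; nlinarith)
      (by push_cast; nlinarith) 1022
    have hshift := real_lrRect_shift hμ ![511 * m, 0] (-((576 * (k * m) : ℕ) : ℤ) - t)
      (576 * (k * m) : ℕ)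
      (-((64 * (k * m) : ℕ) : ℤ) - t) (64 * (k * m) : ℕ)
    simp only [Matrix.cons_val_zero, Matrix.cons_val_one, Matrix.cons_val_fin_one, mul_zero,
      add_zero] at hshift
    have e1 : (-((576 * (k * m) : ℕ) : ℤ) - t + k * (511 * m) : ℤ) =
        -(((64 * (k * m) : ℕ) : ℤ) + (k * m : ℕ)) - t := by push_cast; ring
    have e2 : (((576 * (k * m) : ℕ) : ℤ) + k * (511 * m) : ℤ) =
        ((64 * (k * m) : ℕ) : ℤ) + (k * m : ℕ) + (1022 : ℕ) * (k * m) := by push_cast; ring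
    rw [e1, e2] at hshift
    calc (1 - δ) ^ 2302 ≤ (1 - δ) ^ (2 * 1022 + 1) := pow_le_pow_of_le_one h1δ h1δ' (by norm_num)
      _ ≤ _ := pow_le_pow_left₀ h1δ hC.le _
      _ ≤ _ := hext
      _ = _ := hshift
  · -- first case: arches
    have hlr : -((k * m : ℕ) : ℤ) - t < (k * m : ℕ) := by push_cast; linarith
    have hF := mul_le_real_arch hμ hL hPS (L := -(((64 * (k * m) : ℕ) : ℤ) + (k * m : ℕ)) - t)
      (R := ((64 * (k * m) : ℕ) : ℤ) + (k * m : ℕ)) (B := -((64 * (k * m) : ℕ) : ℤ) - t)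
      (T := (64 * (k * m) : ℕ)) (xl := -((k * m : ℕ) : ℤ) - t) (xr := (k * m : ℕ))
      (by push_cast; nlinarith) hlr (by push_cast; nlinarith) (by push_cast; nlinarith)
    rw [real_flip_parts hμ (B := -((64 * (k * m) : ℕ) : ℤ) - t) (T := ((64 * (k * m) : ℕ) : ℤ))
      (by push_cast; ring) (by push_cast; ring) (-((64 * (k * m) : ℕ) : ℤ) - t)] at hF
    have hE2 : (1 - δ) * (1 - δ) ≤ _ := (mul_le_mul hE.le hE.le h1δ (h1δ.trans hE.le)).trans hF
    have harch := pow_real_arch_le_real_lrRect hμ hL hAr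
      (L := -(((64 * (k * m) : ℕ) : ℤ) + (k * m : ℕ)) - t)
      (R := ((64 * (k * m) : ℕ) : ℤ) + (k * m : ℕ)) (B := -((64 * (k * m) : ℕ) : ℤ) - t)
      (T := (64 * (k * m) : ℕ)) (xl := -((k * m : ℕ) : ℤ) - t) (xr := (k * m : ℕ)) (e := m) hlr
      (by push_cast; nlinarith) 1150
    have hshift := real_lrRect_shift hμ ![575 * m, 0] (-((576 * (k * m) : ℕ) : ℤ) - t)
      (576 * (k * m) : ℕ)
      (-((64 * (k * m) : ℕ) : ℤ) - t) (64 * (k * m) : ℕ)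
    simp only [Matrix.cons_val_zero, Matrix.cons_val_one, Matrix.cons_val_fin_one, mul_zero,
      add_zero] at hshift
    have e1 : (-((576 * (k * m) : ℕ) : ℤ) - t + k * (575 * m) : ℤ) = -((k * m : ℕ) : ℤ) - t := by
      push_cast; ring
    have e2 : (((576 * (k * m) : ℕ) : ℤ) + k * (575 * m) : ℤ) =
        ((k * m : ℕ) : ℤ) + (1150 : ℕ) * (k * m) := by
      push_cast; ring
    rw [e1, e2] at hshift
    calc (1 - δ) ^ 2302 = ((1 - δ) * (1 - δ)) ^ (1150 + 1) := by rw [← sq, ← pow_mul]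
      _ ≤ _ := pow_le_pow_left₀ (mul_nonneg h1δ h1δ) hE2 _
      _ ≤ _ := harch
      _ = _ := hshift

/-! ### Lemma 1(ii) -/

/-- **Lemma 1(ii) of [KohlerSchindlerTassion2023], weak periodic form (Comment 1): short crossings
give arms.** For `ε > 0` and `N₀` put `δ = min(ε / 4604, 1)`, `a₀ = δ⁵`, `N₁ = max N₀ 1`. If an
admissible, lattice-carried `μ` had `μ(arm t (n/64) n) < a₀` at a scale `n ≥ N₁` with `64k ∣ n`,
then for the dual measure `μ* = μ ∘ dualConfig⁻¹` (admissible with offset `t + 1`) the bridge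
variant of `R_{t+1}(n + n/64, n)` would have probability `> 1 - δ⁵` (`one_sub_dual_bridge_le_arm`),
hence `R_{t+1}(9n, n)` a dual horizontal crossing of probability `≥ (1 - δ)^{2302} ≥ 1 - 2302 δ`
(`real_long_of_bridge`), which excludes the short-way crossing `𝓒_t(N, 8N)`, `N = n + k`, up to
probability `2302 δ ≤ ε / 2 < ε` (`real_crossing_add_dual_lrRect_le_one`) — contradicting the
hypothesis at the scale `N`. [cite: KohlerSchindlerTassion2023, Lemma 1(ii) and Comment 1] -/
theorem armsOfShortCrossings_of (hk : 1 ≤ k) (hAr : ArchesMeet) (hPS : PartsToSegmentsMeet)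
    (hDu : ArmDuality) : ArmsOfShortCrossings k t := by
  intro ε hε N₀
  set δ : ℝ := min (ε / 4604) 1 with hδ
  have hδ0 : 0 < δ := lt_min (by positivity) one_pos
  have hδ1 : δ ≤ 1 := min_le_right _ _
  have hδε : 4604 * δ ≤ ε := by
    have := min_le_left (ε / 4604) 1
    linarith
  -- Bernoulli's inequality
  have hbern : 1 - 2302 * δ ≤ (1 - δ) ^ 2302 := by
    have h := one_add_mul_le_pow (show (-2 : ℝ) ≤ -δ by linarith) 2302
    have h' : (1 : ℝ) + ((2302 : ℕ) : ℝ) * -δ = 1 - 2302 * δ := by push_cast; ring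
    rwa [h', ← sub_eq_add_neg] at h
  -- hide the power from `linarith`
  generalize hP : (1 - δ) ^ 2302 = P at hbern
  refine ⟨δ ^ 5, by positivity, max N₀ 1, ?_⟩
  intro μ _ hμ hL hcross n hn hdiv
  obtain ⟨m, hm⟩ := hdiv
  have hm1 : 1 ≤ m := by
    rcases Nat.eq_zero_or_pos m with h0 | h0
    · rw [h0, mul_zero] at hm; omega
    · exact h0
  have ha1 : 1 ≤ k * m := Nat.one_le_iff_ne_zero.2 (Nat.mul_ne_zero (by omega) (by omega))
  have hak : k ≤ k * m := Nat.le_mul_of_pos_right k hm1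
  have hn64 : n = 64 * (k * m) := by rw [hm]; ring
  subst hn64
  have hdiv64 : 64 * (k * m) / 64 = k * m := by omega
  rw [hdiv64]
  by_contra hlt
  push Not at hlt
  -- the dual measure
  haveI := isProbabilityMeasure_map_dualConfig μ
  have hμ' := admissible_map_dualConfig hμ
  have hL' := latticeCarried_map_dualConfig μ
  -- the dual bridge variant is very likely
  have harm := one_sub_dual_bridge_le_arm hDu hL (μ := μ) (t := t) (a := k * m) (n := 64 * (k * m))
    (by omega) ha1
  have hbr : 1 - δ ^ 5 < (μ.map dualConfig).real (bridge (t + 1) (k * m) (64 * (k * m))) := by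
    linarith only [harm, hlt]
  -- hence a long dual crossing is very likely
  have hlong := real_long_of_bridge hAr hPS hμ' hL' hk hm1 hδ0.le hδ1 hbr
  -- which excludes the short-way crossing at the scale `N = n + k`
  have hN := real_crossing_add_dual_lrRect_le_one hDu hμ hL (N := 64 * (k * m) + k) (by omega)
  have hcr := hcross (64 * (k * m) + k) (by omega)
    (Dvd.dvd.add (Dvd.intro (64 * m) (by ring)) (dvd_refl k))
  have hnar : (μ.map dualConfig).real (lrRect (-((576 * (k * m) : ℕ) : ℤ) - ((t + 1 : ℕ) : ℤ))
      (576 * (k * m) : ℕ) (-((64 * (k * m) : ℕ) : ℤ) - ((t + 1 : ℕ) : ℤ)) (64 * (k * m) : ℕ)) ≤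
      (μ.map dualConfig).real (lrRect (-((8 * (64 * (k * m) + k) : ℕ) : ℤ) - t - 2)
      ((8 * (64 * (k * m) + k) : ℕ) + 1) (-((64 * (k * m) + k : ℕ) : ℤ) - t)
      ((64 * (k * m) + k : ℕ) - 1)) := by
    have hak' : (k : ℤ) ≤ (k * m : ℕ) := by exact_mod_cast hak
    have hk' : (1 : ℤ) ≤ k := by exact_mod_cast hk
    exact real_lrRect_mono hL' (by push_cast at hak' ⊢; omega) (by push_cast at hak' ⊢; omega)
      (by push_cast at hak' ⊢; omega) (by push_cast; omega) (by push_cast; omega)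
  -- conclusion
  rw [hP] at hlong
  linarith only [hε, hδε, hbern, hlong, hnar, hN, hcr]

end KSTPeriodic

end

end Literature.Probability.Percolation
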